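import Mathlib.GroupTheory.Index
import Mathlib.GroupTheory.GroupAction.Quotient
import Mathlib.GroupTheory.GroupAction.ConjAct
import Mathlib.Algebra.Group.Subgroup.Pointwise
import Mathlib.Data.Set.Card
import Mathlib.Tactic.Group
import HarnessLib

/-!
# The number of left cosets in a double coset `K b K`: orbit–stabiliser, the lower bound `[K ∩ N : b(K ∩ N)b⁻¹]`, and
# Casselman's exact count for an Iwahori-factorised `K` (Casselman 1995, Prop. 1.4.4; Cartier 1979, §IV.1)

Topic `NumberTheory/Automorphic`; namespace `Literature.NumberTheory.Automorphic.DoubleCosetIndex`.  THEOREMS ONLY (pure group theory: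
no topology, no measure; no definition, no named fact, no instance, no notation, no `sorry`).  Cell `hodgecm-mathlib`, F0∕P3 «U3-mult»,
N5 road (Casselman's square-integrability criterion ★ `UnitaryGroup.U3SquareIntegrableExponents` [Casselman1995, Thm. 4.4.6]), file (R3a)
of the GROUP∕MEASURE half (seat B-p04 (g31)); the representation half is ★ `Representation.heckeRay` (`JacquetRayHeckeOperator`, F0P3-p01).
The hypothesis shapes (`hfac`, `hbM`, `hbN`, `hbNbar`) are those of that file, so that the criterion file composes both halves.

SETTING.  `G` a group, `K ≤ G` (the compact open subgroup of the application), `b ∈ G` (a power `aᵐ` of a dominant torus element),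
`bKb⁻¹ = ConjAct.toConjAct b • K` (Mathlib's pointwise conjugation action).

RESULTS.
* §1 **`stabilizer_coe_eq`**: the stabiliser in `K` of the point `bK ∈ G ⧸ K` is `K ∩ bKb⁻¹`;
  **`ncard_orbit_eq_relIndex`**: `#(K b K ∕ K) = #(K · bK) = [K : K ∩ bKb⁻¹]` (orbit–stabiliser, Mathlib `MulAction.index_stabilizer`);
  `exists_finset_bijOn_orbit`: a `Finset` transversal `X` of `KbK ∕ K` with `#X = [K : K ∩ bKb⁻¹]` whenever this index is finite — the
  input shape of ★ `SphericalCoefficient.measure_image_doubleCoset_eq_card_mul` (`μ((KbK)Z∕Z) = #X · μ(KZ∕Z)`).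
* §2 **`relIndex_conj_inf_le`** — the LOWER BOUND with NO factorisation: if `b⁻¹ N b ⊆ N` then
  `[K ∩ N : (K ∩ N) ∩ b(K ∩ N)b⁻¹] ≤ [K : K ∩ bKb⁻¹]` (the map `(K ∩ N) ∕ ((K ∩ N) ∩ bKb⁻¹) → K ∕ (K ∩ bKb⁻¹)` is injective and
  `(K ∩ N) ∩ bKb⁻¹ = (K ∩ N) ∩ b(K ∩ N)b⁻¹`).  With the Haar identity `[K ∩ N : b(K ∩ N)b⁻¹] = δ_P(b)⁻¹` (sequel) this is the volume growth
  `μ(K aᵐ K) ≥ μ(K) δ_P(a)⁻ᵐ` behind the ⇒ half of [Casselman1995, Thm. 4.4.6].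
* §3 Casselman's Prop. 1.4.4 for an IWAHORI-FACTORISED `K = (K ∩ N̄)(K ∩ M)(K ∩ N)` (as sets, ★ `ParabolicTriple.IwahoriDatum.factorization`'s
  shape) with UNIQUE `N`-component in `N̄ · M · N` (`hinj`) and `b` dominant (`[b, K ∩ M] = 1`, `b(K ∩ N)b⁻¹ ⊆ K`, `b⁻¹(K ∩ N̄)b ⊆ K ∩ N̄`,
  `b^{±1} N b^{∓1} ⊆ N`): **`mem_inf_conj_smul_iff`** — `K ∩ bKb⁻¹ = (K ∩ N̄)(K ∩ M)·b(K ∩ N)b⁻¹`; **`relIndex_inf_conj_smul_eq_of_factorization`** —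
  `[K : K ∩ bKb⁻¹] = [K ∩ N : b(K ∩ N)b⁻¹]` EXACTLY (the coset map `n ↦ n(K ∩ bKb⁻¹)` from `K ∩ N` is onto because `K = (K ∩ N)·(K ∩ bKb⁻¹)`),
  hence `#(KbK ∕ K) = [K ∩ N : b(K ∩ N)b⁻¹]` (`ncard_orbit_eq_relIndex_conj_inf`) — the volume growth `μ(K aᵐ K) = μ(K) δ_P(a)⁻ᵐ` EXACTLY,
  behind the ⇐ half of the criterion.

## References
* [Casselman1995] W. Casselman, *Introduction to the theory of admissible representations of `p`-adic reductive groups* (draft 1 May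
  1995), Prop. 1.4.4 p. 14 (Iwahori factorisation of `K ∩ aKa⁻¹`), §1.5, Thm. 4.4.6 p. 45.
* [CartierCorvallis1979] P. Cartier, *Representations of 𝔭-adic groups: a survey*, PSPM 33.1 (1979), §IV.1 («`ind(KgK)` = number of left
  cosets in `KgK`»), §III.3.
* [BruhatTits1972] F. Bruhat, J. Tits, *Groupes réductifs sur un corps local I*, Publ. Math. IHÉS 41 (1972), (4.4.4).
-/

set_option autoImplicit false

open scoped Pointwise
open MulAction

namespace Literature.NumberTheory.Automorphic

namespace DoubleCosetIndex

variable {G : Type*} [Group G]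

/-! ## §1 Orbit–stabiliser for `K` acting on `G ⧸ K`: `#(KbK ∕ K) = [K : K ∩ bKb⁻¹]` -/

/-- `x ∈ bKb⁻¹ ↔ b⁻¹ x b ∈ K` (Mathlib's `ConjAct` pointwise action on subgroups; private copy of a bookkeeping lemma that exists
elsewhere in the tree). [folklore] -/
private theorem mem_conj_smul_iff (K : Subgroup G) (b x : G) : x ∈ ConjAct.toConjAct b • K ↔ b⁻¹ * x * b ∈ K := by
  rw [Subgroup.mem_pointwise_smul_iff_inv_smul_mem, ← map_inv, ConjAct.toConjAct_smul, inv_inv]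

/-- **The stabiliser in `K` of the point `bK ∈ G ⧸ K` is `K ∩ bKb⁻¹`** (read inside `K`). [cite: CartierCorvallis1979, §IV.1] -/
theorem stabilizer_coe_eq (K : Subgroup G) (b : G) :
    stabilizer K ((b : G) : G ⧸ K) = (ConjAct.toConjAct b • K).subgroupOf K := by
  ext k
  rw [mem_stabilizer_iff, Subgroup.mem_subgroupOf, mem_conj_smul_iff]
  change ((k : G) • ((b : G) : G ⧸ K) : G ⧸ K) = (b : G ⧸ K) ↔ _
  rw [Quotient.smul_coe, smul_eq_mul, QuotientGroup.eq]
  have : (↑k * b)⁻¹ * b = (b⁻¹ * ↑k * b)⁻¹ := by group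
  rw [this, inv_mem_iff]

/-- **Orbit–stabiliser: `#(K · bK) = [K : K ∩ bKb⁻¹]`** — the number of left cosets `xK ⊆ KbK` (Cartier's `ind(KbK)`) is the index of
`K ∩ bKb⁻¹` in `K` (Mathlib `relIndex`; `0` when infinite on both sides). [cite: CartierCorvallis1979, §IV.1] [cite: Casselman1995, §1.5] -/
theorem ncard_orbit_eq_relIndex (K : Subgroup G) (b : G) :
    (orbit K ((b : G) : G ⧸ K)).ncard = (ConjAct.toConjAct b • K).relIndex K := by
  rw [← index_stabilizer, stabilizer_coe_eq, Subgroup.relIndex]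

/-- `[K : K ∩ bKb⁻¹]` as the relative index of the intersection. [cite: CartierCorvallis1979, §IV.1] -/
theorem relIndex_inf_conj_smul (K : Subgroup G) (b : G) :
    (K ⊓ ConjAct.toConjAct b • K).relIndex K = (ConjAct.toConjAct b • K).relIndex K := by
  rw [inf_comm, Subgroup.inf_relIndex_right]

/-- **A `Finset` transversal of `KbK ∕ K`**: when `[K : K ∩ bKb⁻¹]` is finite there is `X : Finset G` mapped bijectively onto the orbit
`K · bK ⊆ G ⧸ K` by `x ↦ xK`, with `#X = [K : K ∩ bKb⁻¹]` — the transversal consumed by ★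
`SphericalCoefficient.measure_image_doubleCoset_eq_card_mul`. [cite: CartierCorvallis1979, §IV.1] -/
theorem exists_finset_bijOn_orbit (K : Subgroup G) (b : G) (hfin : (ConjAct.toConjAct b • K).relIndex K ≠ 0) :
    ∃ X : Finset G, Set.BijOn (fun x : G => (x : G ⧸ K)) X (orbit K ((b : G) : G ⧸ K)) ∧
      X.card = (ConjAct.toConjAct b • K).relIndex K := by
  classical
  have hne : (orbit K ((b : G) : G ⧸ K)).ncard ≠ 0 := by rwa [ncard_orbit_eq_relIndex]
  have hfinite : (orbit K ((b : G) : G ⧸ K)).Finite := Set.finite_of_ncard_ne_zero hne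
  refine ⟨hfinite.toFinset.image Quotient.out, ⟨?_, ?_, ?_⟩, ?_⟩
  · intro x hx
    obtain ⟨p, hp, rfl⟩ := Finset.mem_image.1 (Finset.mem_coe.1 hx)
    simp only [QuotientGroup.out_eq']
    exact hfinite.mem_toFinset.1 hp
  · intro x hx y hy hxy
    obtain ⟨p, -, rfl⟩ := Finset.mem_image.1 (Finset.mem_coe.1 hx)
    obtain ⟨q, -, rfl⟩ := Finset.mem_image.1 (Finset.mem_coe.1 hy)
    simp only [QuotientGroup.out_eq'] at hxy
    rw [hxy]
  · intro p hp
    refine ⟨p.out, Finset.mem_coe.2 (Finset.mem_image.2 ⟨p, hfinite.mem_toFinset.2 hp, rfl⟩), ?_⟩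
    simp only [QuotientGroup.out_eq']
  · rw [← ncard_orbit_eq_relIndex, Set.ncard_eq_toFinset_card _ hfinite,
      Finset.card_image_of_injective _ (fun p q h => by simpa using congrArg (fun x : G => (x : G ⧸ K)) h)]

/-! ## §2 The lower bound `[K ∩ N : (K ∩ N) ∩ b(K ∩ N)b⁻¹] ≤ [K : K ∩ bKb⁻¹]` (no factorisation) -/

/-- `(K ∩ N) ∩ bKb⁻¹ = (K ∩ N) ∩ b(K ∩ N)b⁻¹` when `b⁻¹ N b ⊆ N`. [cite: Casselman1995, Prop. 1.4.4] -/
theorem inf_inf_conj_smul_eq (K N : Subgroup G) {b : G} (hbN : ∀ n ∈ N, b⁻¹ * n * b ∈ N) :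
    (K ⊓ N) ⊓ ConjAct.toConjAct b • K = (K ⊓ N) ⊓ ConjAct.toConjAct b • (K ⊓ N) := by
  ext x
  simp only [Subgroup.mem_inf, mem_conj_smul_iff]
  constructor
  · rintro ⟨⟨hxK, hxN⟩, hbx⟩
    exact ⟨⟨hxK, hxN⟩, hbx, hbN x hxN⟩
  · rintro ⟨⟨hxK, hxN⟩, hbx, -⟩
    exact ⟨⟨hxK, hxN⟩, hbx⟩

/-- **The lower bound** `[K ∩ N : (K ∩ N) ∩ b(K ∩ N)b⁻¹] ≤ [K : K ∩ bKb⁻¹]` for `b⁻¹ N b ⊆ N` and `[K : K ∩ bKb⁻¹] < ∞`: the coset map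
`(K ∩ N) ∕ ((K ∩ N) ∩ bKb⁻¹) → K ∕ (K ∩ bKb⁻¹)` is injective (Mathlib `relIndex_le_of_le_right`).  In the application `K ∩ N ⊇ b(K ∩ N)b⁻¹`
(`b = aᵐ` contracts `N ∩ K`) and the left side is `[K ∩ N : aᵐ(K ∩ N)a⁻ᵐ] = δ_P(a)⁻ᵐ`. [cite: Casselman1995, Prop. 1.4.4, Thm. 4.4.6]
[cite: CartierCorvallis1979, §IV.1] -/
theorem relIndex_conj_inf_le (K N : Subgroup G) {b : G} (hbN : ∀ n ∈ N, b⁻¹ * n * b ∈ N)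
    (hfin : (ConjAct.toConjAct b • K).relIndex K ≠ 0) :
    ((K ⊓ N) ⊓ ConjAct.toConjAct b • (K ⊓ N)).relIndex (K ⊓ N) ≤ (ConjAct.toConjAct b • K).relIndex K := by
  rw [← inf_inf_conj_smul_eq K N hbN, inf_comm, Subgroup.inf_relIndex_right]
  exact Subgroup.relIndex_le_of_le_right inf_le_left hfin

/-- The same lower bound when `b` CONTRACTS `K ∩ N` into itself (`b(K ∩ N)b⁻¹ ⊆ K`, `b N b⁻¹ ⊆ N`): then
`(K ∩ N) ∩ b(K ∩ N)b⁻¹ = b(K ∩ N)b⁻¹` and `[K ∩ N : b(K ∩ N)b⁻¹] ≤ [K : K ∩ bKb⁻¹]`. [cite: Casselman1995, Prop. 1.4.4, Thm. 4.4.6] -/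
theorem relIndex_conj_le_of_contracts (K N : Subgroup G) {b : G} (hbN : ∀ n ∈ N, b⁻¹ * n * b ∈ N)
    (hbN' : ∀ n ∈ N, b * n * b⁻¹ ∈ N) (hbKN : ∀ n ∈ K ⊓ N, b * n * b⁻¹ ∈ K)
    (hfin : (ConjAct.toConjAct b • K).relIndex K ≠ 0) :
    (ConjAct.toConjAct b • (K ⊓ N)).relIndex (K ⊓ N) ≤ (ConjAct.toConjAct b • K).relIndex K := by
  have hle : ConjAct.toConjAct b • (K ⊓ N) ≤ K ⊓ N := by
    intro x hx
    rw [mem_conj_smul_iff] at hx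
    have hx' : x = b * (b⁻¹ * x * b) * b⁻¹ := by group
    rw [hx']
    exact ⟨hbKN _ hx, hbN' _ hx.2⟩
  have h := relIndex_conj_inf_le K N hbN hfin
  rwa [inf_eq_right.2 hle] at h

/-! ## §3 Casselman's Prop. 1.4.4: `K ∩ bKb⁻¹ = (K ∩ N̄)(K ∩ M)·b(K ∩ N)b⁻¹` and the exact count -/

section Factorised

variable {K Nbar M N : Subgroup G} {b : G}

/-- `n̄ ∈ K ∩ N̄` and `m ∈ K ∩ M` lie in `K ∩ bKb⁻¹` for `b` dominant. [cite: Casselman1995, Prop. 1.4.4] -/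
theorem mul_mem_inf_conj_smul_of_dominant (hbM : ∀ m ∈ K ⊓ M, m * b = b * m)
    (hbNbar : ∀ nb ∈ K ⊓ Nbar, b⁻¹ * nb * b ∈ K ⊓ Nbar) {nb m : G} (hnb : nb ∈ K ⊓ Nbar) (hm : m ∈ K ⊓ M) :
    nb * m ∈ K ⊓ ConjAct.toConjAct b • K := by
  refine Subgroup.mem_inf.2 ⟨K.mul_mem hnb.1 hm.1, ?_⟩
  rw [mem_conj_smul_iff]
  have : b⁻¹ * (nb * m) * b = (b⁻¹ * nb * b) * m := by
    rw [show b⁻¹ * (nb * m) * b = (b⁻¹ * nb * b) * (b⁻¹ * (m * b)) by group, hbM m hm]; group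
  rw [this]
  exact K.mul_mem (hbNbar nb hnb).1 hm.1

/-- **Casselman's Prop. 1.4.4 — `K ∩ bKb⁻¹ = (K ∩ N̄)(K ∩ M)·b(K ∩ N)b⁻¹`.**  For `K = (K ∩ N̄)(K ∩ M)(K ∩ N)` (as sets), `N`-components
unique in `N̄·M·N` (`hinj`), and `b` dominant (`[b, K ∩ M] = 1`, `b(K ∩ N)b⁻¹ ⊆ K`, `b⁻¹(K ∩ N̄)b ⊆ K ∩ N̄`, `b⁻¹Nb ⊆ N`, `bNb⁻¹ ⊆ N`):
`x ∈ K ∩ bKb⁻¹` iff `x = n̄ m n` with `n̄ ∈ K ∩ N̄`, `m ∈ K ∩ M`, `n ∈ b(K ∩ N)b⁻¹`. [cite: Casselman1995, Prop. 1.4.4 p. 14] -/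
theorem mem_inf_conj_smul_iff
    (hfac : (K : Set G) = ((K ⊓ Nbar : Subgroup G) : Set G) * ((K ⊓ M : Subgroup G) : Set G) * ((K ⊓ N : Subgroup G) : Set G))
    (hinj : ∀ nb ∈ Nbar, ∀ m ∈ M, ∀ n ∈ N, ∀ nb' ∈ Nbar, ∀ m' ∈ M, ∀ n' ∈ N, nb * m * n = nb' * m' * n' → n = n')
    (hbM : ∀ m ∈ K ⊓ M, m * b = b * m) (hbKN : ∀ n ∈ K ⊓ N, b * n * b⁻¹ ∈ K)
    (hbNbar : ∀ nb ∈ K ⊓ Nbar, b⁻¹ * nb * b ∈ K ⊓ Nbar) (hbN : ∀ n ∈ N, b⁻¹ * n * b ∈ N) (hbN' : ∀ n ∈ N, b * n * b⁻¹ ∈ N)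
    (x : G) :
    x ∈ K ⊓ ConjAct.toConjAct b • K ↔
      ∃ nb ∈ K ⊓ Nbar, ∃ m ∈ K ⊓ M, ∃ n ∈ ConjAct.toConjAct b • (K ⊓ N), x = nb * m * n := by
  constructor
  · intro hx
    obtain ⟨hxK, hxb⟩ := Subgroup.mem_inf.1 hx
    have hxK' : x ∈ ((K : Subgroup G) : Set G) := hxK
    rw [hfac] at hxK'
    obtain ⟨y, hy, n, hn, rfl⟩ := Set.mem_mul.1 hxK'
    obtain ⟨nb, hnb, m, hm, rfl⟩ := Set.mem_mul.1 hy
    have hnb' : nb ∈ K ⊓ Nbar := hnb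
    have hm' : m ∈ K ⊓ M := hm
    have hn' : n ∈ K ⊓ N := hn
    refine ⟨nb, hnb', m, hm', n, ?_, rfl⟩
    -- `b⁻¹ x b ∈ K` factorises as `(b⁻¹ n̄ b) m (b⁻¹ n b)` and as `n̄₁ m₁ n₁`; uniqueness of the `N`-component
    rw [mem_conj_smul_iff] at hxb ⊢
    have hyK : b⁻¹ * (nb * m * n) * b ∈ ((K : Subgroup G) : Set G) := hxb
    rw [hfac] at hyK
    obtain ⟨y₁, hy₁, n₁, hn₁, hprod⟩ := Set.mem_mul.1 hyK
    obtain ⟨nb₁, hnb₁, m₁, hm₁, rfl⟩ := Set.mem_mul.1 hy₁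
    have hnb₁' : nb₁ ∈ K ⊓ Nbar := hnb₁
    have hm₁' : m₁ ∈ K ⊓ M := hm₁
    have hn₁' : n₁ ∈ K ⊓ N := hn₁
    have hsplit : b⁻¹ * (nb * m * n) * b = (b⁻¹ * nb * b) * m * (b⁻¹ * n * b) := by
      rw [show b⁻¹ * (nb * m * n) * b = (b⁻¹ * nb * b) * (b⁻¹ * (m * b)) * (b⁻¹ * n * b) by group, hbM m hm']
      group
    rw [hsplit] at hprod
    have heq := hinj _ (hbNbar nb hnb').2 _ hm'.2 _ (hbN n hn'.2) _ hnb₁'.2 _ hm₁'.2 _ hn₁'.2 hprod.symm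
    rw [heq]
    exact hn₁'
  · rintro ⟨nb, hnb, m, hm, n, hn, rfl⟩
    have hn' : b⁻¹ * n * b ∈ K ⊓ N := (mem_conj_smul_iff _ _ _).1 hn
    have hnKN : n ∈ K ⊓ N := by
      have : n = b * (b⁻¹ * n * b) * b⁻¹ := by group
      rw [this]
      exact Subgroup.mem_inf.2 ⟨hbKN _ hn', hbN' _ hn'.2⟩
    refine Subgroup.mem_inf.2 ⟨K.mul_mem (K.mul_mem hnb.1 hm.1) hnKN.1, ?_⟩
    rw [mem_conj_smul_iff]
    have hsplit : b⁻¹ * (nb * m * n) * b = (b⁻¹ * nb * b) * m * (b⁻¹ * n * b) := by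
      rw [show b⁻¹ * (nb * m * n) * b = (b⁻¹ * nb * b) * (b⁻¹ * (m * b)) * (b⁻¹ * n * b) by group, hbM m hm]
      group
    rw [hsplit]
    exact K.mul_mem (K.mul_mem (hbNbar nb hnb).1 hm.1) hn'.1

/-- `(K ∩ bKb⁻¹) ∩ N = b(K ∩ N)b⁻¹` under the hypotheses of `mem_inf_conj_smul_iff` (an element `n̄ m n ∈ N` has `n̄ m n = n`).
[cite: Casselman1995, Prop. 1.4.4 p. 14] -/
theorem inf_conj_smul_inf_eq
    (hfac : (K : Set G) = ((K ⊓ Nbar : Subgroup G) : Set G) * ((K ⊓ M : Subgroup G) : Set G) * ((K ⊓ N : Subgroup G) : Set G))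
    (hinj : ∀ nb ∈ Nbar, ∀ m ∈ M, ∀ n ∈ N, ∀ nb' ∈ Nbar, ∀ m' ∈ M, ∀ n' ∈ N, nb * m * n = nb' * m' * n' → n = n')
    (hbM : ∀ m ∈ K ⊓ M, m * b = b * m) (hbKN : ∀ n ∈ K ⊓ N, b * n * b⁻¹ ∈ K)
    (hbNbar : ∀ nb ∈ K ⊓ Nbar, b⁻¹ * nb * b ∈ K ⊓ Nbar) (hbN : ∀ n ∈ N, b⁻¹ * n * b ∈ N) (hbN' : ∀ n ∈ N, b * n * b⁻¹ ∈ N) :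
    (K ⊓ ConjAct.toConjAct b • K) ⊓ N = ConjAct.toConjAct b • (K ⊓ N) := by
  ext x
  rw [Subgroup.mem_inf]
  constructor
  · rintro ⟨hx, hxN⟩
    obtain ⟨nb, hnb, m, hm, n, hn, rfl⟩ := (mem_inf_conj_smul_iff hfac hinj hbM hbKN hbNbar hbN hbN' _).1 hx
    have hn' : b⁻¹ * n * b ∈ K ⊓ N := (mem_conj_smul_iff _ _ _).1 hn
    have hnN : n ∈ N := by
      have : n = b * (b⁻¹ * n * b) * b⁻¹ := by group
      rw [this]; exact hbN' _ hn'.2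
    have heq := hinj nb hnb.2 m hm.2 n hnN 1 Nbar.one_mem 1 M.one_mem (nb * m * n) hxN (by group)
    -- `n = n̄ m n`
    rw [← heq]; exact hn
  · intro hx
    have hx' : b⁻¹ * x * b ∈ K ⊓ N := (mem_conj_smul_iff _ _ _).1 hx
    have hxKN : x ∈ K ⊓ N := by
      have : x = b * (b⁻¹ * x * b) * b⁻¹ := by group
      rw [this]; exact Subgroup.mem_inf.2 ⟨hbKN _ hx', hbN' _ hx'.2⟩
    refine ⟨(mem_inf_conj_smul_iff hfac hinj hbM hbKN hbNbar hbN hbN' x).2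
      ⟨1, (K ⊓ Nbar).one_mem, 1, (K ⊓ M).one_mem, x, hx, by group⟩, hxKN.2⟩

/-- **`K = (K ∩ N) · (K ∩ bKb⁻¹)`**: every `k ∈ K` is `n h` with `n ∈ K ∩ N`, `h ∈ K ∩ bKb⁻¹` (write `k⁻¹ = n̄ m n`, so `k = n⁻¹ (m⁻¹ n̄⁻¹)`).
[cite: Casselman1995, Prop. 1.4.4 p. 14] -/
theorem exists_mul_eq_of_factorization
    (hfac : (K : Set G) = ((K ⊓ Nbar : Subgroup G) : Set G) * ((K ⊓ M : Subgroup G) : Set G) * ((K ⊓ N : Subgroup G) : Set G))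
    (hbM : ∀ m ∈ K ⊓ M, m * b = b * m) (hbNbar : ∀ nb ∈ K ⊓ Nbar, b⁻¹ * nb * b ∈ K ⊓ Nbar) {k : G} (hk : k ∈ K) :
    ∃ n ∈ K ⊓ N, ∃ h ∈ K ⊓ ConjAct.toConjAct b • K, k = n * h := by
  have hk' : k⁻¹ ∈ ((K : Subgroup G) : Set G) := K.inv_mem hk
  rw [hfac] at hk'
  obtain ⟨y, hy, n, hn, hprod⟩ := Set.mem_mul.1 hk'
  obtain ⟨nb, hnb, m, hm, rfl⟩ := Set.mem_mul.1 hy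
  have hnb' : nb ∈ K ⊓ Nbar := hnb
  have hm' : m ∈ K ⊓ M := hm
  have hn' : n ∈ K ⊓ N := hn
  refine ⟨n⁻¹, (K ⊓ N).inv_mem hn', (nb * m)⁻¹, (K ⊓ ConjAct.toConjAct b • K).inv_mem
    (mul_mem_inf_conj_smul_of_dominant hbM hbNbar hnb' hm'), ?_⟩
  rw [← inv_inv k, ← hprod, mul_inv_rev]

/-- **The exact count `[K : K ∩ bKb⁻¹] = [K ∩ N : b(K ∩ N)b⁻¹]`** for an Iwahori-factorised `K` and dominant `b` (Casselman's Prop. 1.4.4: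
the coset map `n ↦ n·(K ∩ bKb⁻¹)` from `K ∩ N` is onto, with fibres the cosets of `(K ∩ bKb⁻¹) ∩ N = b(K ∩ N)b⁻¹`).  With the Haar identity
`[K ∩ N : aᵐ(K ∩ N)a⁻ᵐ] = δ_P(a)⁻ᵐ` this is `μ(K aᵐ K) = μ(K) · δ_P(a)⁻ᵐ`. [cite: Casselman1995, Prop. 1.4.4 p. 14, §1.5] [cite: BruhatTits1972, (4.4.4)] -/
theorem relIndex_inf_conj_smul_eq_of_factorization
    (hfac : (K : Set G) = ((K ⊓ Nbar : Subgroup G) : Set G) * ((K ⊓ M : Subgroup G) : Set G) * ((K ⊓ N : Subgroup G) : Set G))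
    (hinj : ∀ nb ∈ Nbar, ∀ m ∈ M, ∀ n ∈ N, ∀ nb' ∈ Nbar, ∀ m' ∈ M, ∀ n' ∈ N, nb * m * n = nb' * m' * n' → n = n')
    (hbM : ∀ m ∈ K ⊓ M, m * b = b * m) (hbKN : ∀ n ∈ K ⊓ N, b * n * b⁻¹ ∈ K)
    (hbNbar : ∀ nb ∈ K ⊓ Nbar, b⁻¹ * nb * b ∈ K ⊓ Nbar) (hbN : ∀ n ∈ N, b⁻¹ * n * b ∈ N) (hbN' : ∀ n ∈ N, b * n * b⁻¹ ∈ N) :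
    (K ⊓ ConjAct.toConjAct b • K).relIndex K = (ConjAct.toConjAct b • (K ⊓ N)).relIndex (K ⊓ N) := by
  classical
  set H : Subgroup G := K ⊓ ConjAct.toConjAct b • K with hH
  have hHN : H ⊓ N = ConjAct.toConjAct b • (K ⊓ N) := inf_conj_smul_inf_eq hfac hinj hbM hbKN hbNbar hbN hbN'
  -- `[K ∩ N : b(K ∩ N)b⁻¹] = [K ∩ N : H ∩ (K ∩ N)]`
  have h1 : (ConjAct.toConjAct b • (K ⊓ N)).relIndex (K ⊓ N) = H.relIndex (K ⊓ N) := by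
    rw [← Subgroup.inf_relIndex_right H, show H ⊓ (K ⊓ N) = H ⊓ N from by
      rw [← inf_assoc, show H ⊓ K = H from inf_eq_left.2 inf_le_left], hHN]
  rw [h1, Subgroup.relIndex, Subgroup.relIndex]
  -- the coset spaces `K ∕ H` and `(K ∩ N) ∕ (H ∩ (K ∩ N))` are in bijection
  refine Nat.card_congr ?_
  symm
  let ι : ↥(K ⊓ N) →* ↥K := Subgroup.inclusion inf_le_left
  have hι : ∀ x : ↥(K ⊓ N), x ∈ H.subgroupOf (K ⊓ N) ↔ ι x ∈ H.subgroupOf K := fun x => by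
    simp only [Subgroup.mem_subgroupOf, Subgroup.coe_inclusion, ι]
  refine Equiv.ofBijective
    (Quotient.map' ι fun x y hxy => by
      rw [QuotientGroup.leftRel_apply] at hxy ⊢
      rw [← map_inv, ← map_mul]
      exact (hι _).1 hxy) ⟨?_, ?_⟩
  · -- injective
    intro p q hpq
    induction p using Quotient.inductionOn' with | h x => ?_
    induction q using Quotient.inductionOn' with | h y => ?_
    have hpq' : (QuotientGroup.mk (ι x) : ↥K ⧸ H.subgroupOf K) = QuotientGroup.mk (ι y) := hpq
    rw [QuotientGroup.eq] at hpq'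
    change (QuotientGroup.mk x : ↥(K ⊓ N) ⧸ H.subgroupOf (K ⊓ N)) = QuotientGroup.mk y
    rw [QuotientGroup.eq, hι, map_mul, map_inv]
    exact hpq'
  · -- surjective: `k = n h`
    intro p
    induction p using Quotient.inductionOn' with | h k => ?_
    obtain ⟨n, hn, h, hh, hk⟩ := exists_mul_eq_of_factorization hfac hbM hbNbar k.2
    refine ⟨QuotientGroup.mk ⟨n, hn⟩, ?_⟩
    change (QuotientGroup.mk (ι ⟨n, hn⟩) : ↥K ⧸ H.subgroupOf K) = QuotientGroup.mk k
    rw [QuotientGroup.eq, Subgroup.mem_subgroupOf]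
    have : ((ι ⟨n, hn⟩)⁻¹ * k : ↥K) = (n⁻¹ * k : G) := rfl
    rw [this, hk, inv_mul_cancel_left]
    exact hh

/-- **`#(K b K ∕ K) = [K ∩ N : b(K ∩ N)b⁻¹]`** for an Iwahori-factorised `K` and dominant `b` (§1 + `relIndex_inf_conj_smul_eq_of_factorization`).
[cite: Casselman1995, Prop. 1.4.4 p. 14, §1.5] [cite: CartierCorvallis1979, §IV.1] -/
theorem ncard_orbit_eq_relIndex_conj_inf
    (hfac : (K : Set G) = ((K ⊓ Nbar : Subgroup G) : Set G) * ((K ⊓ M : Subgroup G) : Set G) * ((K ⊓ N : Subgroup G) : Set G))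
    (hinj : ∀ nb ∈ Nbar, ∀ m ∈ M, ∀ n ∈ N, ∀ nb' ∈ Nbar, ∀ m' ∈ M, ∀ n' ∈ N, nb * m * n = nb' * m' * n' → n = n')
    (hbM : ∀ m ∈ K ⊓ M, m * b = b * m) (hbKN : ∀ n ∈ K ⊓ N, b * n * b⁻¹ ∈ K)
    (hbNbar : ∀ nb ∈ K ⊓ Nbar, b⁻¹ * nb * b ∈ K ⊓ Nbar) (hbN : ∀ n ∈ N, b⁻¹ * n * b ∈ N) (hbN' : ∀ n ∈ N, b * n * b⁻¹ ∈ N) :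
    (orbit K ((b : G) : G ⧸ K)).ncard = (ConjAct.toConjAct b • (K ⊓ N)).relIndex (K ⊓ N) := by
  rw [ncard_orbit_eq_relIndex, ← relIndex_inf_conj_smul, relIndex_inf_conj_smul_eq_of_factorization hfac hinj hbM hbKN hbNbar hbN hbN']

end Factorised

end DoubleCosetIndex

end Literature.NumberTheory.Automorphic
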